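import Mathlib
import HarnessLib
import Literature.Computability.AlgebraicComplexity.DepthThreeRankBound
import Literature.GroupTheory.QuasirandomGroups.AlternatingProductMixing
import Summits.ValiantsHypothesis.ValiantsHypothesis.Theses.MonotoneRestoration
import Summits.ValiantsHypothesis.ValiantsHypothesis.Theorems.MonotoneRestorationMixingScalePolyScale

/-!
## rev 10 (width seat val-width-18293-ms1 g0, 2026-08-28, per director RULING g11-R67 (3)): RE-POINTED TO THE TREE
Every definition and every non-residual stub of this line is now a LANDED declaration of namespace
`Summit.ValiantsHypothesis.ValiantsHypothesis.Theorems.OrbitRestorationQPMixingScale` — files `Theorems/MonotoneRestorationMixingScale*.lean`: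
`Defs` (p600419/p601910/p602843: OrbitClose, orbitClass, AlmostInvariantTerms, OrbitClassSums, EssStableAlt, SpanOneUAlt [4·dim W + 8 ≤ n],
PiSigmaValue, PolyScaleStructure, GrowingFaninRestoration, GrowingFaninResidual) · `LevelMatchingData` (p600616, FACT A) · `OrbitClassSums`
(p601193, M3 `stub_orbitClassSums`) · `AlmostInvariantTerms` (p601705, M2 `stub_almostInvariantTerms`, mixing fact = Literature
`alternatingProductMixing` p600358) · `EssStableAlt` (p602355, M4a) · `SpanOneUAlt` (p602629, M4b) · `GrowingFanin` (p603096, M5 `growingFanin`)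
· `OrbitDatum` (p603654) + `OrbitStructure` (p604058) + `PolyScale` (p604312: M4c `stub_polyScaleStructure`, `growingFaninRestoration_of_facts`).
The proofs that lived in this workfile up to rev 9 (val-idea-12 g0, porting sha dee8417b1908479d / d4f53fd9ea19) are in the tree's history and in
`pub/ideators/val-idea-12/Lines/`; this file now imports the tree and keeps exactly ONE sorry, the declared residual.  The narrative of the
line (rev 9 header) follows unchanged.
-/

/-!
# Line `mixing-scale` — crux `OrbitRestorationQP` (stmt-ValiantsHypothesis-18293), lens = nearmiss (val-idea-12, D-0145/D-0148)

BEARS ON the rung `SigmaPiSigmaRestorationQP = ProductDepthRestorationQP (fun _ => 1)` (Theorems-side name; first rung of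
the product-depth ladder under `X = OrbitRestorationQP`, line of record `Lines/depth_three_rung.lean`).

THE MEASURED NEAR-MISS.  The landed sub-rung A_k (`Theorems.OrbitRestorationQPDepthThreeRung.stub_sigmaPiSigmaKValue`,
p594347) proves restoration for matrix-symmetric `ΣΠΣ` families of top fan-in `k` at levels
`n ≥ levelThreshold k c ≥ 4 · dimConst k c ^ 2`, and `dimConst k c` contains the factor `(2k+2)^(k²)`
(`SigmaKThresholds.dimConst`): the argument reaches top fan-in `k(n) ≲ √(log n / log log n)` and no further.  The SINGLE input
responsible is the good-scale lemma (`RankClustering.exists_good_scale`: a scale `θ = (2m+2)^{m₀}(Rb+1)`, `m₀ ≤ m²`, at which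
single-linkage clusters of the terms are `2·Rb + diam`-separated) — the tower is the price of SEPARATION (`Setting.hsep`).

THE LEVER (new on this crux: product mixing in the quasirandom group `A_n`, Gowers 2008 / Nikolov–Pyber 2011, applied to the
POPULARITY SETS of the rank-bound matching).  FACT A (rank bound on the minimal vanishing sub-sums of `f − g·f`): for every
`g ∈ Sym_n` and every term `i` some term `j` has `rdist (L i) (g · L j) ≤ Rb`.  Pigeonhole over `j` gives a set
`Σ_ij ⊆ Sym_n` of density `≥ 1/m`; `Σ_ij⁻¹ Σ_ij ⊆ E_j(2Rb) := {ρ : rdist (L j) (ρ · L j) ≤ 2Rb}`, the sets `E_j(t)` are symmetric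
and `E_j(s) · E_j(t) ⊆ E_j(s+t)`; so `E_j(4Rb) ∩ A_n` has density `≥ 1/m` in `A_n`, and MIXING (`|Z|³ > |A_n|³/(n−1) ⇒ Z·Z·Z = A_n`,
valid as soon as `m³ < n − 1`) gives `A_n ⊆ E_j(12 Rb)`; transporting back along FACT A, EVERY term is `14·Rb`-almost
invariant under `A_n` (rows; same for columns; `28·Rb` under `A_n × A_n`) — `almostInvariantTerms` (M2, PROVED rev 5).  Consequently the
ORBIT-LINKED classes (`i ≈ j` iff some even `(σ,τ)` puts `L j` within `Rb` of `L i`, transitively closed) have (a) class sums that are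
EXACTLY `A_n × A_n`-invariant (`orbitClassSums`, M3, PROVED rev 6, from the rank-bound bridge alone: sum the minimal vanishing sub-sums of
`f − g·f` class by class) and (b) PLAIN rank-diameter `≤ (m−1)·29·Rb` — i.e. a `Setting`-like datum with `Θ = poly(m)·Rb` and
invariant class sums INSTEAD of separated clusters.  The level-structure pipeline then runs at the POLYNOMIAL threshold
`A_c · (k+1)^7 · (log₂ n + 1) ≤ n` WITHOUT a tower: `E :=` the span of the essential variables of the non-linear parts of the class sums
is even-stable with `finrank E ≤ m(1+m²Θ)` (M4a `essStableAlt`); `16·finrank E + 8 ≤ n ⇒ E ⊆ span(1,U)` under the EVEN action (M4b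
`spanOneUAlt`, coset trick), so every non-linear part is `Q_a(U)`; the affine product `P_a` of a class is even-invariant by cancellation,
and — instead of controlling odd renamings — `f` is AVERAGED over the Klein group `S_n×S_n / A_n×A_n` (`f = ¼ Σ_g g·f`), which writes
`f = Σ_a (u_a/4) · (Σ_g g·P_a) · Q_a(U)` with MATRIX-SYMMETRIC four-sums (`mact_klein`): Theorem S′ in FOUR-SUM form (M4c
`polyScaleStructure4`, PROVED rev 9).  Each four-sum is a matrix-symmetric `ΣΠΣ(4)` polynomial, so the LANDED `SigmaPiSigmaK.level_data`
with `k = 4` (constant threshold) splits it into matrix-symmetric affine products times `Q(U)`, and the A_k-style assembly (uniformised A₁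
`piSigmaValue_uniform` + uniform finite sums `qpOrbitRestorable_sum_uniform`) yields restoration for GROWING top fan-in
`κ(n) ≲ (n / log n)^{1/7}` (M5 `growingFanin4`, PROVED)
(`GrowingFaninRestoration`, a new rung strictly between `⋀_k A_k` and `A_∞`; calibrations `growingFanin_of_rung`,
`boundedFanin_threshold`).  The complement (top fan-in beyond every polynomial threshold `(n/log n)^{1/7}`, where rank bounds are
vacuous anyway for `κ ≥ √n`) is the declared residual `GrowingFaninResidual`, never staffed.

STATUS (rev 9, 2026-08-28): `GrowingFaninRestoration` is PROVED in this file (`growingFanin_of`) from the named inputs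
`AlternatingMixing` (Gowers 2008 / Nikolov–Pyber 2011; to be typed under `Literature/`), `depthThree_rankBound` and the registered open
stub A₁ (`PiSigmaValue`, line of record) — FACT A, M2, M3, M4a, M4b, M4c, M5 are all kernel-checked here (axioms: propext,
Classical.choice, Quot.sound); the ONLY `sorry` left is the declared, never-staffed residual `stub_residual : GrowingFaninResidual`,
through which the line reaches the rung BY NAME (`sigmaPiSigmaRestorationQP_of`).

VP ≠ VNP is NOT moved: this replaces one input (the scale tower) of one sub-rung of the first rung under a tier-B crux.

Disproof used: the crux workfile's dead lines — exact term stability (`SupersededStubA`, sign characters / `V_n`), exact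
invariance of INDIVIDUAL terms under a large subgroup (gauge splitting `u₁u₂ = g·u₂ + (u₁−g)u₂`), single-scale plain clustering
(bad scales) — are all honoured: the line never asserts invariance of a term, only `O(Rb)`-ALMOST-invariance of its normalised
factor multiset in RANK distance (gauge splitting moves a term by rank ≤ 2), and exact invariance only of CLASS sums.
-/


noncomputable section

open Literature.Computability.AlgebraicComplexity Literature.GroupTheory.QuasirandomGroups
open Summit.ValiantsHypothesis.ValiantsHypothesis.Theorems.OrbitRestorationQPDepthThreeRung
open Summit.ValiantsHypothesis.ValiantsHypothesis.Theorems.OrbitRestorationQPMixingScale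

-- `Summit.ValiantsHypothesis.ValiantsHypothesis.…` is the tree's single-conjunct layout (Sub = Summit).
set_option linter.dupNamespace false

namespace Summit.ValiantsHypothesis.ValiantsHypothesis.Cruxes.OrbitRestorationQP.MixingScale

/-! ### Registered obligations (sorries live only here) -/

/-- **DECLARED RESIDUAL** (never staffed; the honest remainder of A_∞). [folklore] -/
theorem stub_residual : GrowingFaninResidual := by
  sorry

/-! ### Compositions (kernel-checked, no sorry of their own) -/

/-- The new rung from the named inputs: mixing + rank bound + A₁ — every other stub of the line is a landed theorem. -/
theorem growingFanin_of (hmix : alternatingProductMixing) (hRB : depthThree_rankBound) (hA1 : PiSigmaValue) :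
    GrowingFaninRestoration :=
  growingFaninRestoration_of_facts hmix hRB hA1

/-- **THE LINE CONCLUDES THE RUNG BY NAME** (`ProductDepthRestorationQP (fun _ => 1)`), through the declared residual. -/
theorem sigmaPiSigmaRestorationQP_of (hmix : alternatingProductMixing) (hRB : depthThree_rankBound) (hA1 : PiSigmaValue) :
    ProductDepthRestorationQP (fun _ => 1) :=
  stub_residual (growingFanin_of hmix hRB hA1)

end Summit.ValiantsHypothesis.ValiantsHypothesis.Cruxes.OrbitRestorationQP.MixingScale

end
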